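import Summits.QuantumFields.YangMills.Theorems.BalabanUVNodesN09ChartReadAveragingSubmersion
import Mathlib.Analysis.Calculus.InverseFunctionTheorem.ContDiff
import HarnessLib

/-!
# BalabanUVNodes ∕ N09 — (M3r)-LOCAL, ONE-BOND EDITION: «`B′(b₀(c))` CAN BE EXPRESSED IN TERMS OF THE REMAINING VARIABLES» ([Balaban1987RG1] p. 267) AS A KERNEL FACT —
# the (0.4) average at `c`, read in the exponential charts as a function of the ONE private coordinate `U(β(c))`, is a local `C^ω`-diffeomorphism of `𝔰𝔲(N)` at every guarded configuration

Cell `pub-ymgap`, width seat `pub-ymgap-dag-n09-w4` generation 5 (HUMAN RULING D-0149; DAG node N09 = [Balaban1987RG1] §§2–5; INBOX CLAIM-3∕INTENT-4 l.35867).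
`--kind proof --supports stmt-QuantumFields-27364 --as helper` (K1⁹ `StabilityBRunRowsAtRecordR13SepCoPHV`, rev 29; count-neutral; theorems only, 0 def ∕ 0 instance ∕ 0 notation ∕ 0 sorry).
Files 1–2 of the lane: `…N09ChartReadAveragingSmooth` (p620237), `…N09ChartReadAveragingSubmersion` (p621434).

WHY.  Print ([I] p. 267, after (2.10)): *«these variables [at `b₀(c)`] can be expressed in terms of the remaining ones as in the first step»* — the central crossing bond `β(c)` is a
PRIVATE COORDINATE of the (0.4) average at `c` (`BlockAveragingHaarAC`: `Ū(c′)`, `c′ ≠ c`, is blind to `U(β(c))`).  dag-n09-w6's private-coordinate road to `hreg` displays per-bond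
INVERSIONS of the one-variable maps `g ↦ Ū(U[β(c) ↦ g])(c)`; it proves WINDOW injectivity by contraction (`EMLFibreMapInjective`) and takes measurable inverses by Lusin–Souslin.  THIS FILE
is the complementary LOCAL ANALYTIC statement, from files 1–2: read in the exponential charts centred at `U(β(c))` and `Ū(U)(c)`, the one-variable map
`φ_{U₀,c} : X ↦ Λ(Ū(U₀[β(c) ↦ Θ(X)·U₀(β(c))])(c)·Ū(U₀)(c)⁻¹) = ψ_{U₀}(X δ_{β(c)})(c)` is `C^ω` at `0` (§1), its derivative at `0` is `X ↦ (Dψ_{U₀}(0)[X δ_{β(c)}])(c)` — dag-n07-w2's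
central response, ONTO `𝔰𝔲(N)` by file 2 hence a linear AUTOMORPHISM (§2) —, so by Mathlib's inverse function theorem it is a LOCAL `C^ω`-DIFFEOMORPHISM at `0` (§3): the nonlinear, local
content of print's sentence, with an analytic inverse.  It is also the `C¹`-in-the-chart input of this seat's g4 `haar_restrict_image_eq_map_withDensity_jacobian` for the FORWARD Jacobian law
of the fibre map (the successor file, on dag-n09-w6's windows).

CONTENTS (CONSUMED BY NAME, nothing modified: files 1–2 — `contDiffAt_chartRead_avgFun`, `piExpChart_translate_smul_single`, `piExpChart_translate_zero`, `hasDerivAt_along_ray`,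
`exists_fderiv_chartRead_single_apply_self`; dag-n09-w2's `logChart_one`; Mathlib `contDiff_single`, `LinearMap.injective_iff_surjective`, `LinearEquiv.ofBijective`,
`ContDiffAt.toOpenPartialHomeomorph` ∕ `to_localInverse`).
§0 `hasDerivAt_along_ray_apply` (generic).  §1 `piExpChart_translate_single` · ★ `contDiffAt_oneBond` · `analyticAt_oneBond` · `oneBond_zero` · `fderiv_oneBond_apply`.
§2 ★★ `oneBond_fderiv_surjective` · ★★ `exists_hasFDerivAt_equiv_oneBond`.  §3 ★★★ `exists_localInverse_oneBond`.

DISPLAYED HYPOTHESES.  Standing range `j + 1 ≤ m + K`; the guard `∀ c, Small expMeanLogSU U₀ c` (§1); the loop α-guard AT `c`: `dist1 (loopHol U₀ c i) ≤ α`, `α ≤ 1∕24`, `α < δ_N`,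
`157·α < L^{1−d}` (§2–§3; dag-n07-w2's constants).

HONEST FRAMING.  LOCATED, count-neutral kernel calculus on the tree's OWN averaging; the windows `O`, `V` are ∃-radii from the inverse function theorem — NOT blind to the other private
coordinates, NOT uniform in `U₀` (dag-n09-w6's `Ωα` is the quantitative object); NO chart of Bałaban's constructed ((2.10)'s explicit `B′ = B − hD̃(B)` untouched), NO estimate; `hreg` ∕ N09
NOT discharged; conjunct 1 (Lemma 4) ∕ FLAG №7 untouched; K0⁷ ∕ K1⁹ ∕ K3⁸ NOT closed; counts unmoved (typed 28∕28 · discharged 5∕28); no summit statement is proved here; R4 = the conditional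
finite-𝕋⁴ rung `BalabanLadder.UV` only — NOT continuum ∕ ℝ⁴ ∕ OS; the Yang–Mills mass gap (Clay) is NOT proved by any of this.
-/

noncomputable section

open scoped Matrix.Norms.L2Operator Topology ContDiff
open Filter Set Function MeasureTheory

namespace Summit.QuantumFields.YangMills.BalabanUVNodes.N09OneBondChartRead

open Literature.MathematicalPhysics.QuantumFieldTheory.Balaban1983to89
open Literature.MathematicalPhysics.QuantumFieldTheory.Balaban1983to89.HaarExponentialChart
open Literature.MathematicalPhysics.QuantumFieldTheory.Balaban1983to89.HaarExponentialChart.IsChartRep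
open Literature.MathematicalPhysics.QuantumFieldTheory.Balaban1983to89.BlockAveraging (Small Idx avgFun loopHol)
open Literature.MathematicalPhysics.QuantumFieldTheory.Balaban1983to89.BlockAveragingHaarAC (centralBond isLocal_avgFun)
open Literature.MathematicalPhysics.QuantumFieldTheory.Balaban1983to89.ExpMeanLog (expMeanLogSU deltaSU)
open Literature.MathematicalPhysics.QuantumFieldTheory.Balaban1983to89.Node00
open Summit.QuantumFields.YangMills.BalabanUVNodes.N09ChartReadAveragingSmooth
open Summit.QuantumFields.YangMills.BalabanUVNodes.N09ChartReadAveragingSubmersion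

/-! ## §0  A generic ray lemma -/

section Generic

variable {E F : Type*} [NormedAddCommGroup E] [NormedSpace ℝ E] [NormedAddCommGroup F] [NormedSpace ℝ F] {ι : Type*} [Fintype ι]

/-- A component of a differentiable family-valued map along the ray `t ↦ t·a` has derivative `(Df(0) a) i` at `t = 0`. [folklore] -/
theorem hasDerivAt_along_ray_apply {f : E → ι → F} (hf : DifferentiableAt ℝ f 0) (a : E) (i : ι) :
    HasDerivAt (fun t : ℝ => f (t • a) i) (fderiv ℝ f 0 a i) 0 :=
  (hasDerivAt_pi.1 (hasDerivAt_along_ray hf a)) i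

end Generic

/-! ## §1–§3  The one-bond chart-read average: analytic at `0`, derivative = the central response (an automorphism), local analytic inverse -/

section OneBond

variable {P : Params} {j : ℕ} {N : ℕ} [NeZero N]
variable (U₀ : GaugeField P j (SU N)) (c : PBond P (j + 1))

/-- The one-bond chart direction: `Θ^B(X δ_{β(c)})·U₀ = U₀[β(c) ↦ Θ(X)·U₀(β(c))]` — the chart coordinate at the central crossing bond `β(c)` alone is the update of that one bond
(file 1's `piExpChart_translate_smul_single` at `t = 1`). [cite: Balaban1987RG1, p.267 («these variables can be expressed in terms of the remaining ones»; bookkeeping)] -/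
theorem piExpChart_translate_single (X : (specialUnitaryLogChart (Fin N)).lie) :
    (fun b => (isChartRep_specialUnitaryGroup (n := Fin N)).expChart ((Pi.single (centralBond c) X : PBond P j → (specialUnitaryLogChart (Fin N)).lie) b) * U₀ b) =
      Function.update U₀ (centralBond c) ((isChartRep_specialUnitaryGroup (n := Fin N)).expChart X * U₀ (centralBond c)) := by
  have h := piExpChart_translate_smul_single (P := P) (j := j) U₀ (centralBond c) X 1
  rwa [one_smul, one_smul] at h

/-- ★ **THE ONE-BOND CHART-READ AVERAGE IS `C^ω` AT `0`**: `X ↦ ψ_{U₀}(X δ_{β(c)})(c) = Λ(Ū(U₀[β(c) ↦ Θ(X)·U₀(β(c))])(c)·Ū(U₀)(c)⁻¹)` is `ContDiffAt ℝ ⊤` (= analytic) at `0` on the guard (file 1's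
`contDiffAt_chartRead_avgFun` composed with the linear maps `X ↦ X δ_β` and `· ↦ ·(c)`). [cite: Balaban1987RG1, (0.4) p.253, p.267] -/
theorem contDiffAt_oneBond (hsmall : ∀ c, Small (expMeanLogSU (n := Fin N)) U₀ c) :
    ContDiffAt ℝ ⊤ (fun X : (specialUnitaryLogChart (Fin N)).lie =>
      (isChartRep_specialUnitaryGroup (n := Fin N)).logChart
        (avgFun (expMeanLogSU (n := Fin N)) (fun b => (isChartRep_specialUnitaryGroup (n := Fin N)).expChart
            ((Pi.single (centralBond c) X : PBond P j → (specialUnitaryLogChart (Fin N)).lie) b) * U₀ b) c *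
          (avgFun (expMeanLogSU (n := Fin N)) U₀ c)⁻¹)) 0 := by
  set ψ := fun (A : PBond P j → (specialUnitaryLogChart (Fin N)).lie) (c : PBond P (j + 1)) =>
      (isChartRep_specialUnitaryGroup (n := Fin N)).logChart (avgFun (expMeanLogSU (n := Fin N))
        (fun b => (isChartRep_specialUnitaryGroup (n := Fin N)).expChart (A b) * U₀ b) c * (avgFun (expMeanLogSU (n := Fin N)) U₀ c)⁻¹) with hψ
  have hψc : ContDiffAt ℝ ⊤ ψ 0 := contDiffAt_chartRead_avgFun (P := P) (j := j) U₀ hsmall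
  have hι := contDiff_single (𝕜 := ℝ) (fun _ : PBond P j => (specialUnitaryLogChart (Fin N)).lie) ⊤ (centralBond c)
  have h1 : ContDiffAt ℝ ⊤ ψ (Pi.single (centralBond c) (0 : (specialUnitaryLogChart (Fin N)).lie)) := by rw [Pi.single_zero]; exact hψc
  have hcomp : ContDiffAt ℝ ⊤ (fun X : (specialUnitaryLogChart (Fin N)).lie => ψ (Pi.single (centralBond c) X)) 0 :=
    ContDiffAt.comp (0 : (specialUnitaryLogChart (Fin N)).lie) h1 hι.contDiffAt
  exact (contDiffAt_pi.1 hcomp) c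

/-- ★ … hence REAL-ANALYTIC at `0` (`⊤ = ω`). [cite: Balaban1987RG1, p.253 («analytic function»)] -/
theorem analyticAt_oneBond (hsmall : ∀ c, Small (expMeanLogSU (n := Fin N)) U₀ c) :
    AnalyticAt ℝ (fun X : (specialUnitaryLogChart (Fin N)).lie =>
      (isChartRep_specialUnitaryGroup (n := Fin N)).logChart
        (avgFun (expMeanLogSU (n := Fin N)) (fun b => (isChartRep_specialUnitaryGroup (n := Fin N)).expChart
            ((Pi.single (centralBond c) X : PBond P j → (specialUnitaryLogChart (Fin N)).lie) b) * U₀ b) c *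
          (avgFun (expMeanLogSU (n := Fin N)) U₀ c)⁻¹)) 0 :=
  (contDiffAt_oneBond (P := P) (j := j) U₀ c hsmall).analyticAt

/-- The one-bond chart-read average vanishes at `0` (`Θ 0 = 1`, `Λ 1 = 0`). [cite: Helgason2000, Ch. I §1 Thm. 1.14 (13) p. 96 (bookkeeping)] -/
theorem oneBond_zero :
    (isChartRep_specialUnitaryGroup (n := Fin N)).logChart
        (avgFun (expMeanLogSU (n := Fin N)) (fun b => (isChartRep_specialUnitaryGroup (n := Fin N)).expChart
            ((Pi.single (centralBond c) (0 : (specialUnitaryLogChart (Fin N)).lie) : PBond P j → (specialUnitaryLogChart (Fin N)).lie) b) * U₀ b) c *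
          (avgFun (expMeanLogSU (n := Fin N)) U₀ c)⁻¹) = 0 := by
  rw [Pi.single_zero, piExpChart_translate_zero, mul_inv_cancel, (isChartRep_specialUnitaryGroup (n := Fin N)).logChart_one]

/-- The derivative of the one-bond chart-read average: `Dφ(0) X = (Dψ_{U₀}(0)[X δ_{β(c)}])(c)` (both are the velocity of `t ↦ ψ_{U₀}(t·X δ_β)(c)` at `0`).
[cite: Balaban1987RG1, (0.4) p.253 (bookkeeping)] -/
theorem fderiv_oneBond_apply (hsmall : ∀ c, Small (expMeanLogSU (n := Fin N)) U₀ c) (X : (specialUnitaryLogChart (Fin N)).lie) :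
    fderiv ℝ (fun X : (specialUnitaryLogChart (Fin N)).lie =>
      (isChartRep_specialUnitaryGroup (n := Fin N)).logChart
        (avgFun (expMeanLogSU (n := Fin N)) (fun b => (isChartRep_specialUnitaryGroup (n := Fin N)).expChart
            ((Pi.single (centralBond c) X : PBond P j → (specialUnitaryLogChart (Fin N)).lie) b) * U₀ b) c *
          (avgFun (expMeanLogSU (n := Fin N)) U₀ c)⁻¹)) 0 X =
      fderiv ℝ (fun (A : PBond P j → (specialUnitaryLogChart (Fin N)).lie) (c : PBond P (j + 1)) =>
        (isChartRep_specialUnitaryGroup (n := Fin N)).logChart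
          (avgFun (expMeanLogSU (n := Fin N)) (fun b => (isChartRep_specialUnitaryGroup (n := Fin N)).expChart (A b) * U₀ b) c *
            (avgFun (expMeanLogSU (n := Fin N)) U₀ c)⁻¹)) 0 (Pi.single (centralBond c) X) c := by
  have hψd := (contDiffAt_chartRead_avgFun (P := P) (j := j) U₀ hsmall).differentiableAt (by simp)
  have hφd := (contDiffAt_oneBond (P := P) (j := j) U₀ c hsmall).differentiableAt (by simp)
  have h1 := hasDerivAt_along_ray hφd X
  have h3 := hasDerivAt_along_ray_apply hψd (Pi.single (centralBond c) X : PBond P j → (specialUnitaryLogChart (Fin N)).lie) c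
  refine h1.unique (h3.congr_of_eventuallyEq (Eventually.of_forall fun t => ?_))
  show _ = (fun (A : PBond P j → (specialUnitaryLogChart (Fin N)).lie) (c : PBond P (j + 1)) =>
        (isChartRep_specialUnitaryGroup (n := Fin N)).logChart
          (avgFun (expMeanLogSU (n := Fin N)) (fun b => (isChartRep_specialUnitaryGroup (n := Fin N)).expChart (A b) * U₀ b) c *
            (avgFun (expMeanLogSU (n := Fin N)) U₀ c)⁻¹)) (t • (Pi.single (centralBond c) X : PBond P j → (specialUnitaryLogChart (Fin N)).lie)) c
  rw [← Pi.single_smul]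

/-- ★★ **THE DERIVATIVE OF THE ONE-BOND CHART-READ AVERAGE AT `0` IS ONTO `𝔰𝔲(N)`** under the loop α-guard (its value on `X` is the `c`-component of `Dψ_{U₀}(0)[X δ_{β(c)}]`, onto by file 2's
`exists_fderiv_chartRead_single_apply_self` = dag-n07-w2's central response). [cite: Balaban1985Averaging, Prop. 3 (124) p.36; Balaban1987RG1, (0.4), (0.8) p.253] -/
theorem oneBond_fderiv_surjective (hj : j + 1 ≤ P.m + P.K) (hsmall : ∀ c, Small (expMeanLogSU (n := Fin N)) U₀ c) {α : ℝ}
    (hα : ∀ i, dist1 (loopHol U₀ c i) ≤ α) (hα24 : α ≤ 1 / 24) (hαδ : α < deltaSU (Fin N)) (hαL : 157 * α < ((P.L : ℝ) ^ (P.d - 1))⁻¹) :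
    Function.Surjective (fderiv ℝ (fun X : (specialUnitaryLogChart (Fin N)).lie =>
      (isChartRep_specialUnitaryGroup (n := Fin N)).logChart
        (avgFun (expMeanLogSU (n := Fin N)) (fun b => (isChartRep_specialUnitaryGroup (n := Fin N)).expChart
            ((Pi.single (centralBond c) X : PBond P j → (specialUnitaryLogChart (Fin N)).lie) b) * U₀ b) c *
          (avgFun (expMeanLogSU (n := Fin N)) U₀ c)⁻¹)) 0) := by
  intro z
  obtain ⟨X, hX⟩ := exists_fderiv_chartRead_single_apply_self (P := P) (j := j) hj hsmall c hα hα24 hαδ hαL z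
  exact ⟨X, by rw [fderiv_oneBond_apply (P := P) (j := j) U₀ c hsmall X]; exact hX⟩

/-- ★★ **THE DERIVATIVE AT `0` IS A LINEAR AUTOMORPHISM OF `𝔰𝔲(N)`** (onto + finite dimension ⇒ bijective), packaged as a `ContinuousLinearEquiv` carrying `HasFDerivAt`.
[cite: Balaban1985Averaging, Prop. 3 (124) p.36; Balaban1987RG1, p.267] -/
theorem exists_hasFDerivAt_equiv_oneBond (hj : j + 1 ≤ P.m + P.K) (hsmall : ∀ c, Small (expMeanLogSU (n := Fin N)) U₀ c) {α : ℝ}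
    (hα : ∀ i, dist1 (loopHol U₀ c i) ≤ α) (hα24 : α ≤ 1 / 24) (hαδ : α < deltaSU (Fin N)) (hαL : 157 * α < ((P.L : ℝ) ^ (P.d - 1))⁻¹) :
    ∃ e : (specialUnitaryLogChart (Fin N)).lie ≃L[ℝ] (specialUnitaryLogChart (Fin N)).lie,
      HasFDerivAt (fun X : (specialUnitaryLogChart (Fin N)).lie =>
        (isChartRep_specialUnitaryGroup (n := Fin N)).logChart
          (avgFun (expMeanLogSU (n := Fin N)) (fun b => (isChartRep_specialUnitaryGroup (n := Fin N)).expChart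
              ((Pi.single (centralBond c) X : PBond P j → (specialUnitaryLogChart (Fin N)).lie) b) * U₀ b) c *
            (avgFun (expMeanLogSU (n := Fin N)) U₀ c)⁻¹)) (e : (specialUnitaryLogChart (Fin N)).lie →L[ℝ] (specialUnitaryLogChart (Fin N)).lie) 0 := by
  set φ := fun X : (specialUnitaryLogChart (Fin N)).lie =>
      (isChartRep_specialUnitaryGroup (n := Fin N)).logChart
        (avgFun (expMeanLogSU (n := Fin N)) (fun b => (isChartRep_specialUnitaryGroup (n := Fin N)).expChart
            ((Pi.single (centralBond c) X : PBond P j → (specialUnitaryLogChart (Fin N)).lie) b) * U₀ b) c *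
          (avgFun (expMeanLogSU (n := Fin N)) U₀ c)⁻¹) with hφ
  have hφd : DifferentiableAt ℝ φ 0 := (contDiffAt_oneBond (P := P) (j := j) U₀ c hsmall).differentiableAt (by simp)
  set L : (specialUnitaryLogChart (Fin N)).lie →L[ℝ] (specialUnitaryLogChart (Fin N)).lie := fderiv ℝ φ 0 with hL
  have hsurj : Function.Surjective L := oneBond_fderiv_surjective (P := P) (j := j) U₀ c hj hsmall hα hα24 hαδ hαL
  have hinj : Function.Injective L := (LinearMap.injective_iff_surjective (f := (L : (specialUnitaryLogChart (Fin N)).lie →ₗ[ℝ] _))).2 hsurj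
  let eL : (specialUnitaryLogChart (Fin N)).lie ≃ₗ[ℝ] (specialUnitaryLogChart (Fin N)).lie :=
    LinearEquiv.ofBijective (L : (specialUnitaryLogChart (Fin N)).lie →ₗ[ℝ] _) ⟨hinj, hsurj⟩
  refine ⟨eL.toContinuousLinearEquiv, ?_⟩
  have hco : ((eL.toContinuousLinearEquiv : (specialUnitaryLogChart (Fin N)).lie ≃L[ℝ] _) :
      (specialUnitaryLogChart (Fin N)).lie →L[ℝ] (specialUnitaryLogChart (Fin N)).lie) = L := by
    ext X; rfl
  rw [hco]
  exact hφd.hasFDerivAt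

/-- ★★★ **«`B′(b₀(c))` CAN BE EXPRESSED IN TERMS OF THE REMAINING VARIABLES» — THE ONE-BOND CHART-READ AVERAGE IS A LOCAL `C^ω`-DIFFEOMORPHISM OF `𝔰𝔲(N)` AT `0`.**  Under the loop
α-guard at `U₀` (standing range): open `O ∋ 0`, `V ∋ 0` in `𝔰𝔲(N)` and `θ : 𝔰𝔲(N) → 𝔰𝔲(N)` such that `φ = X ↦ Λ(Ū(U₀[β(c) ↦ Θ(X)·U₀(β(c))])(c)·Ū(U₀)(c)⁻¹)` is injective on `O` with `φ(O) = V`,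
`θ` inverts it (`θ(φ X) = X` on `O`; `θ Y ∈ O`, `φ(θ Y) = Y` on `V`) and `θ` is `C^∞` (= analytic) at `0` — Mathlib's inverse function theorem (`ContDiffAt.toOpenPartialHomeomorph`) on the
previous two theorems.  Print obtains this from the explicit linearisation `B′ = B − hD̃(B)`; here it is the implicit-function reading of the tree's own (0.4) map, with dag-n07-w2's central
response as the invertible derivative. [cite: Balaban1987RG1, (2.10) and the following sentence p.267; Balaban1985Averaging, Prop. 3 p.36] -/
theorem exists_localInverse_oneBond (hj : j + 1 ≤ P.m + P.K) (hsmall : ∀ c, Small (expMeanLogSU (n := Fin N)) U₀ c) {α : ℝ}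
    (hα : ∀ i, dist1 (loopHol U₀ c i) ≤ α) (hα24 : α ≤ 1 / 24) (hαδ : α < deltaSU (Fin N)) (hαL : 157 * α < ((P.L : ℝ) ^ (P.d - 1))⁻¹) :
    ∃ (O V : Set (specialUnitaryLogChart (Fin N)).lie) (θ : (specialUnitaryLogChart (Fin N)).lie → (specialUnitaryLogChart (Fin N)).lie),
      IsOpen O ∧ (0 : (specialUnitaryLogChart (Fin N)).lie) ∈ O ∧ IsOpen V ∧ (0 : (specialUnitaryLogChart (Fin N)).lie) ∈ V ∧
      Set.InjOn (fun X : (specialUnitaryLogChart (Fin N)).lie =>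
        (isChartRep_specialUnitaryGroup (n := Fin N)).logChart
          (avgFun (expMeanLogSU (n := Fin N)) (fun b => (isChartRep_specialUnitaryGroup (n := Fin N)).expChart
              ((Pi.single (centralBond c) X : PBond P j → (specialUnitaryLogChart (Fin N)).lie) b) * U₀ b) c *
            (avgFun (expMeanLogSU (n := Fin N)) U₀ c)⁻¹)) O ∧
      (fun X : (specialUnitaryLogChart (Fin N)).lie =>
        (isChartRep_specialUnitaryGroup (n := Fin N)).logChart
          (avgFun (expMeanLogSU (n := Fin N)) (fun b => (isChartRep_specialUnitaryGroup (n := Fin N)).expChart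
              ((Pi.single (centralBond c) X : PBond P j → (specialUnitaryLogChart (Fin N)).lie) b) * U₀ b) c *
            (avgFun (expMeanLogSU (n := Fin N)) U₀ c)⁻¹)) '' O = V ∧
      (∀ X ∈ O, θ ((isChartRep_specialUnitaryGroup (n := Fin N)).logChart
          (avgFun (expMeanLogSU (n := Fin N)) (fun b => (isChartRep_specialUnitaryGroup (n := Fin N)).expChart
              ((Pi.single (centralBond c) X : PBond P j → (specialUnitaryLogChart (Fin N)).lie) b) * U₀ b) c *
            (avgFun (expMeanLogSU (n := Fin N)) U₀ c)⁻¹)) = X) ∧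
      (∀ Y ∈ V, θ Y ∈ O ∧ (isChartRep_specialUnitaryGroup (n := Fin N)).logChart
          (avgFun (expMeanLogSU (n := Fin N)) (fun b => (isChartRep_specialUnitaryGroup (n := Fin N)).expChart
              ((Pi.single (centralBond c) (θ Y) : PBond P j → (specialUnitaryLogChart (Fin N)).lie) b) * U₀ b) c *
            (avgFun (expMeanLogSU (n := Fin N)) U₀ c)⁻¹) = Y) ∧
      ContDiffAt ℝ ⊤ θ 0 := by
  set φ := fun X : (specialUnitaryLogChart (Fin N)).lie =>
      (isChartRep_specialUnitaryGroup (n := Fin N)).logChart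
        (avgFun (expMeanLogSU (n := Fin N)) (fun b => (isChartRep_specialUnitaryGroup (n := Fin N)).expChart
            ((Pi.single (centralBond c) X : PBond P j → (specialUnitaryLogChart (Fin N)).lie) b) * U₀ b) c *
          (avgFun (expMeanLogSU (n := Fin N)) U₀ c)⁻¹) with hφ
  haveI : CompleteSpace (specialUnitaryLogChart (Fin N)).lie := FiniteDimensional.complete ℝ _
  have hφc : ContDiffAt ℝ ⊤ φ 0 := contDiffAt_oneBond (P := P) (j := j) U₀ c hsmall
  obtain ⟨e, he⟩ := exists_hasFDerivAt_equiv_oneBond (P := P) (j := j) U₀ c hj hsmall hα hα24 hαδ hαL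
  have hn : (⊤ : WithTop ℕ∞) ≠ 0 := by simp
  set H := hφc.toOpenPartialHomeomorph φ he hn with hH
  have hHφ : (H : (specialUnitaryLogChart (Fin N)).lie → (specialUnitaryLogChart (Fin N)).lie) = φ := hφc.toOpenPartialHomeomorph_coe he hn
  have h0s : (0 : (specialUnitaryLogChart (Fin N)).lie) ∈ H.source := hφc.mem_toOpenPartialHomeomorph_source he hn
  have hφ0 : φ 0 = 0 := oneBond_zero (P := P) (j := j) U₀ c
  have h0t : (0 : (specialUnitaryLogChart (Fin N)).lie) ∈ H.target := by
    have h := hφc.image_mem_toOpenPartialHomeomorph_target he hn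
    rwa [hφ0] at h
  refine ⟨H.source, H.target, H.symm, H.open_source, h0s, H.open_target, h0t, ?_, ?_, ?_, ?_, ?_⟩
  · rw [← hHφ]; exact H.injOn
  · rw [← hHφ]; exact H.image_source_eq_target
  · intro X hX
    have h := H.left_inv hX
    rwa [hHφ] at h
  · intro Y hY
    refine ⟨H.map_target hY, ?_⟩
    have h := H.right_inv hY
    rwa [hHφ] at h
  · have h := hφc.to_localInverse he hn
    rw [hφ0] at h
    exact h

end OneBond

/-! ## §4  Back on the group: the fibre map `g ↦ Ū(U₀[β(c) ↦ g])(c)` is conjugate to `φ` through the translated charts, hence injective on a chart window around `U₀(β(c))` -/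

section Group

variable {P : Params} {j : ℕ} {N : ℕ} [NeZero N]
variable (U₀ : GaugeField P j (SU N)) (c : PBond P (j + 1))

/-- **SEMICONJUGACY**: whenever the relative value `Ū(U₀[β ↦ Θ(X)·U₀(β)])(c)·Ū(U₀)(c)⁻¹` lies in the logarithmic chart (`‖· − 1‖ < r_C`),
`Ū(U₀[β(c) ↦ Θ(X)·U₀(β(c))])(c) = Θ(φ_{U₀,c}(X))·Ū(U₀)(c)` (`Θ ∘ Λ = id` on the chart, p28 `expChart_logChart`). [cite: Helgason2000, Ch. I §1 Thm. 1.14 (13) p. 96 (bookkeeping)] -/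
theorem fibreMap_eq_expChart_oneBond_mul (X : (specialUnitaryLogChart (Fin N)).lie)
    (hX : ‖Literature.MathematicalPhysics.QuantumLattice.fundamentalRep (Fin N)
        (avgFun (expMeanLogSU (n := Fin N)) (Function.update U₀ (centralBond c) ((isChartRep_specialUnitaryGroup (n := Fin N)).expChart X * U₀ (centralBond c))) c *
          (avgFun (expMeanLogSU (n := Fin N)) U₀ c)⁻¹) - 1‖ < innerRadius (specialUnitaryLogChart (Fin N))) :
    avgFun (expMeanLogSU (n := Fin N)) (Function.update U₀ (centralBond c) ((isChartRep_specialUnitaryGroup (n := Fin N)).expChart X * U₀ (centralBond c))) c =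
      (isChartRep_specialUnitaryGroup (n := Fin N)).expChart
          ((isChartRep_specialUnitaryGroup (n := Fin N)).logChart
            (avgFun (expMeanLogSU (n := Fin N)) (fun b => (isChartRep_specialUnitaryGroup (n := Fin N)).expChart
                ((Pi.single (centralBond c) X : PBond P j → (specialUnitaryLogChart (Fin N)).lie) b) * U₀ b) c *
              (avgFun (expMeanLogSU (n := Fin N)) U₀ c)⁻¹)) *
        avgFun (expMeanLogSU (n := Fin N)) U₀ c := by
  rw [piExpChart_translate_single, (isChartRep_specialUnitaryGroup (n := Fin N)).expChart_logChart hX, inv_mul_cancel_right]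

/-- The relative value is continuous in `X` at `0` (where it equals `1`), so it lies in the logarithmic chart for `X` near `0` (the guard AT `c` suffices: dag-n07's
`continuousAt_avgFun_apply_of_small`). [cite: Balaban1987RG1, (0.4) p.253 (bookkeeping)] -/
theorem eventually_relValue_mem_chart (hc : Small (expMeanLogSU (n := Fin N)) U₀ c) :
    ∀ᶠ X in 𝓝 (0 : (specialUnitaryLogChart (Fin N)).lie),
      ‖Literature.MathematicalPhysics.QuantumLattice.fundamentalRep (Fin N)
        (avgFun (expMeanLogSU (n := Fin N)) (Function.update U₀ (centralBond c) ((isChartRep_specialUnitaryGroup (n := Fin N)).expChart X * U₀ (centralBond c))) c *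
          (avgFun (expMeanLogSU (n := Fin N)) U₀ c)⁻¹) - 1‖ < innerRadius (specialUnitaryLogChart (Fin N)) := by
  set h := isChartRep_specialUnitaryGroup (n := Fin N) with hh
  have hupd : Continuous fun X : (specialUnitaryLogChart (Fin N)).lie => Function.update U₀ (centralBond c) (h.expChart X * U₀ (centralBond c)) :=
    continuous_const.update (centralBond c) (h.continuous_expChart.mul continuous_const)
  have h0 : Function.update U₀ (centralBond c) (h.expChart 0 * U₀ (centralBond c)) = U₀ := by
    rw [h.expChart_zero, one_mul, Function.update_eq_self]
  have havg : ContinuousAt (fun X : (specialUnitaryLogChart (Fin N)).lie =>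
      avgFun (expMeanLogSU (n := Fin N)) (Function.update U₀ (centralBond c) (h.expChart X * U₀ (centralBond c))) c) 0 := by
    have h1 : ContinuousAt (fun U : GaugeField P j (SU N) => avgFun (expMeanLogSU (n := Fin N)) U c)
        (Function.update U₀ (centralBond c) (h.expChart 0 * U₀ (centralBond c))) := by
      rw [h0]; exact N07AveragingLocalContinuity.continuousAt_avgFun_apply_of_small c hc
    exact ContinuousAt.comp (f := fun X : (specialUnitaryLogChart (Fin N)).lie => Function.update U₀ (centralBond c) (h.expChart X * U₀ (centralBond c)))
      (x := (0 : (specialUnitaryLogChart (Fin N)).lie)) h1 hupd.continuousAt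
  have hrel : ContinuousAt (fun X : (specialUnitaryLogChart (Fin N)).lie =>
      ‖Literature.MathematicalPhysics.QuantumLattice.fundamentalRep (Fin N)
        (avgFun (expMeanLogSU (n := Fin N)) (Function.update U₀ (centralBond c) (h.expChart X * U₀ (centralBond c))) c *
          (avgFun (expMeanLogSU (n := Fin N)) U₀ c)⁻¹) - 1‖) 0 :=
    continuous_norm.continuousAt.comp (((h.continuous.continuousAt).comp (havg.mul continuousAt_const)).sub continuousAt_const)
  refine hrel.eventually (isOpen_Iio.mem_nhds ?_)
  show ‖Literature.MathematicalPhysics.QuantumLattice.fundamentalRep (Fin N)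
      (avgFun (expMeanLogSU (n := Fin N)) (Function.update U₀ (centralBond c) (h.expChart 0 * U₀ (centralBond c))) c *
        (avgFun (expMeanLogSU (n := Fin N)) U₀ c)⁻¹) - 1‖ < _
  rw [h0, mul_inv_cancel, map_one, sub_self, norm_zero]
  exact innerRadius_pos

/-- ★★ **THE FIBRE MAP IS INJECTIVE ON A CHART WINDOW AROUND `U₀(β(c))`, CONJUGATE TO `φ` THERE.**  Under the loop α-guard: an open `O ∋ 0` inside the chart ball `B(0, s_C)` on which (i) the
one-bond chart-read average `φ` is injective and maps into `B(0, s_C)`, (ii) `Ū(U₀[β ↦ Θ(X)·U₀(β)])(c) = Θ(φ X)·Ū(U₀)(c)`, hence (iii) `X ↦ Ū(U₀[β ↦ Θ(X)·U₀(β)])(c)` is injective on `O` — the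
hypotheses `hψ`, `hψs`, `hΨ` of this seat's g4 `HaarExpChartChangeOfVariables.haar_restrict_image_eq_map_withDensity_jacobian` for the forward Jacobian law of the fibre map (successor file).
[cite: Balaban1987RG1, (2.10) p.267; Helgason2000, Ch. I §1 Thm. 1.14 (13) p. 96] -/
theorem exists_chartWindow_injOn_fibreMap (hj : j + 1 ≤ P.m + P.K) (hsmall : ∀ c, Small (expMeanLogSU (n := Fin N)) U₀ c) {α : ℝ}
    (hα : ∀ i, dist1 (loopHol U₀ c i) ≤ α) (hα24 : α ≤ 1 / 24) (hαδ : α < deltaSU (Fin N)) (hαL : 157 * α < ((P.L : ℝ) ^ (P.d - 1))⁻¹) :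
    ∃ O : Set (specialUnitaryLogChart (Fin N)).lie, IsOpen O ∧ (0 : (specialUnitaryLogChart (Fin N)).lie) ∈ O ∧
      O ⊆ Metric.ball (0 : (specialUnitaryLogChart (Fin N)).lie) (chartRadius (specialUnitaryLogChart (Fin N))) ∧
      Set.InjOn (fun X : (specialUnitaryLogChart (Fin N)).lie =>
        (isChartRep_specialUnitaryGroup (n := Fin N)).logChart
          (avgFun (expMeanLogSU (n := Fin N)) (fun b => (isChartRep_specialUnitaryGroup (n := Fin N)).expChart
              ((Pi.single (centralBond c) X : PBond P j → (specialUnitaryLogChart (Fin N)).lie) b) * U₀ b) c *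
            (avgFun (expMeanLogSU (n := Fin N)) U₀ c)⁻¹)) O ∧
      Set.MapsTo (fun X : (specialUnitaryLogChart (Fin N)).lie =>
        (isChartRep_specialUnitaryGroup (n := Fin N)).logChart
          (avgFun (expMeanLogSU (n := Fin N)) (fun b => (isChartRep_specialUnitaryGroup (n := Fin N)).expChart
              ((Pi.single (centralBond c) X : PBond P j → (specialUnitaryLogChart (Fin N)).lie) b) * U₀ b) c *
            (avgFun (expMeanLogSU (n := Fin N)) U₀ c)⁻¹)) O (Metric.ball 0 (chartRadius (specialUnitaryLogChart (Fin N)))) ∧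
      (∀ X ∈ O, avgFun (expMeanLogSU (n := Fin N)) (Function.update U₀ (centralBond c) ((isChartRep_specialUnitaryGroup (n := Fin N)).expChart X * U₀ (centralBond c))) c =
        (isChartRep_specialUnitaryGroup (n := Fin N)).expChart
            ((isChartRep_specialUnitaryGroup (n := Fin N)).logChart
              (avgFun (expMeanLogSU (n := Fin N)) (fun b => (isChartRep_specialUnitaryGroup (n := Fin N)).expChart
                  ((Pi.single (centralBond c) X : PBond P j → (specialUnitaryLogChart (Fin N)).lie) b) * U₀ b) c *
                (avgFun (expMeanLogSU (n := Fin N)) U₀ c)⁻¹)) *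
          avgFun (expMeanLogSU (n := Fin N)) U₀ c) ∧
      Set.InjOn (fun X : (specialUnitaryLogChart (Fin N)).lie =>
        avgFun (expMeanLogSU (n := Fin N)) (Function.update U₀ (centralBond c) ((isChartRep_specialUnitaryGroup (n := Fin N)).expChart X * U₀ (centralBond c))) c) O := by
  set h := isChartRep_specialUnitaryGroup (n := Fin N) with hh
  set φ := fun X : (specialUnitaryLogChart (Fin N)).lie =>
      h.logChart (avgFun (expMeanLogSU (n := Fin N)) (fun b => h.expChart
          ((Pi.single (centralBond c) X : PBond P j → (specialUnitaryLogChart (Fin N)).lie) b) * U₀ b) c * (avgFun (expMeanLogSU (n := Fin N)) U₀ c)⁻¹) with hφ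
  obtain ⟨O₁, V, θ, hO₁, h0O₁, -, -, hinj, -, -, -, -⟩ := exists_localInverse_oneBond (P := P) (j := j) U₀ c hj hsmall hα hα24 hαδ hαL
  -- `φ` is continuous at `0` with `φ 0 = 0`: it maps a neighbourhood into the chart ball
  have hφc : ContinuousAt φ 0 := (contDiffAt_oneBond (P := P) (j := j) U₀ c hsmall).continuousAt
  have hφ0 : φ 0 = 0 := oneBond_zero (P := P) (j := j) U₀ c
  have hball : ∀ᶠ X in 𝓝 (0 : (specialUnitaryLogChart (Fin N)).lie), φ X ∈ Metric.ball (0 : (specialUnitaryLogChart (Fin N)).lie) (chartRadius (specialUnitaryLogChart (Fin N))) := by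
    have h1 := hφc.eventually (Metric.isOpen_ball.mem_nhds (by rw [hφ0]; exact Metric.mem_ball_self chartRadius_pos :
      φ 0 ∈ Metric.ball (0 : (specialUnitaryLogChart (Fin N)).lie) (chartRadius (specialUnitaryLogChart (Fin N)))))
    exact h1
  have hrel := eventually_relValue_mem_chart (P := P) (j := j) U₀ c (hsmall c)
  have hsrc : ∀ᶠ X in 𝓝 (0 : (specialUnitaryLogChart (Fin N)).lie), X ∈ Metric.ball (0 : (specialUnitaryLogChart (Fin N)).lie) (chartRadius (specialUnitaryLogChart (Fin N))) :=
    Metric.isOpen_ball.mem_nhds (Metric.mem_ball_self chartRadius_pos)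
  obtain ⟨O₂, hO₂sub, hO₂, h0O₂⟩ := _root_.eventually_nhds_iff.1 ((hball.and hrel).and hsrc)
  refine ⟨O₁ ∩ O₂, hO₁.inter hO₂, ⟨h0O₁, h0O₂⟩, fun X hX => ((hO₂sub X hX.2).2), hinj.mono Set.inter_subset_left,
    fun X hX => (hO₂sub X hX.2).1.1, fun X hX => fibreMap_eq_expChart_oneBond_mul (P := P) (j := j) U₀ c X (hO₂sub X hX.2).1.2, ?_⟩
  intro X hX X' hX' hXX'
  have hΘ : h.expChart (φ X) = h.expChart (φ X') := by
    have e1 := fibreMap_eq_expChart_oneBond_mul (P := P) (j := j) U₀ c X (hO₂sub X hX.2).1.2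
    have e2 := fibreMap_eq_expChart_oneBond_mul (P := P) (j := j) U₀ c X' (hO₂sub X' hX'.2).1.2
    have e3 : h.expChart (φ X) * avgFun (expMeanLogSU (n := Fin N)) U₀ c = h.expChart (φ X') * avgFun (expMeanLogSU (n := Fin N)) U₀ c := by
      rw [← e1, ← e2]; exact hXX'
    exact mul_right_cancel e3
  have hφeq : φ X = φ X' := (h.injOn_expChart le_rfl) (hO₂sub X hX.2).1.1 (hO₂sub X' hX'.2).1.1 hΘ
  exact hinj hX.1 hX'.1 hφeq

end Group

end Summit.QuantumFields.YangMills.BalabanUVNodes.N09OneBondChartRead
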